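import Summits.CriticalPhenomena.PercolationContinuityZ3.Theorems.Transplant.PlanarSkeletonFrmQuasiDefs
import Summits.CriticalPhenomena.PercolationContinuityZ3.Theorems.Transplant.SkelFrmQuasiBChoiceResidC
import Summits.CriticalPhenomena.PercolationContinuityZ3.Theorems.Transplant.SkelFrmBChoiceResidC
import Summits.CriticalPhenomena.PercolationContinuityZ3.Theorems.Transplant.SkelFrmQuasiBParamsFaceFloorsZPiYA
import Summits.CriticalPhenomena.PercolationContinuityZ3.Theorems.Transplant.SkelFrmBParamsFaceFloorsZPiYA
import Summits.CriticalPhenomena.PercolationContinuityZ3.Theorems.Transplant.SkelFrmQuasi1ChoiceDefs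
import Summits.CriticalPhenomena.PercolationContinuityZ3.Theorems.Transplant.SkelFrmQuasi1ParamsLBL
import Summits.CriticalPhenomena.PercolationContinuityZ3.Theorems.Transplant.SkelFrmQuasi1ParamsPO
import Summits.CriticalPhenomena.PercolationContinuityZ3.Theorems.Transplant.SkelFrmQuasi1SlotTypes
import Summits.CriticalPhenomena.PercolationContinuityZ3.Theorems.Transplant.SkelFrmQuasiBChoiceNums
import Summits.CriticalPhenomena.PercolationContinuityZ3.Theorems.Transplant.SkelFrmQuasiBParamsFaceFloorsPiXA
import Summits.CriticalPhenomena.PercolationContinuityZ3.Theorems.Transplant.SkelFrmQuasiBParamsLF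
import Summits.CriticalPhenomena.PercolationContinuityZ3.Theorems.Transplant.SkelFrmQuasiBParamsSlotsF
import Summits.CriticalPhenomena.PercolationContinuityZ3.Theorems.Transplant.SkelFrmQuasiBParamsSlotsS
import Summits.CriticalPhenomena.PercolationContinuityZ3.Theorems.Transplant.SkelFrmQuasiBParamsSlotsT
import Summits.CriticalPhenomena.PercolationContinuityZ3.Theorems.Transplant.SkelFrmQuasi1SlotTypes
import HarnessLib
import Summits.CriticalPhenomena.PercolationContinuityZ3.Theorems.Transplant.SkelFrmBChoiceResidF
/-!
# GEN-Q PORT (WAVE-Q table v0.8 section 2, row G206, U-level L21; captain R-6/R-7 2026-08-27: carrier token swap `PlanarSkeletonFrmFrom ↦ PlanarSkeletonFrmQuasi`)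
# of the tree module «Transplant/SkelFrmFromBChoiceResidF» (sha256 7078be50bad9277f…) onto the quasi-step carrier `PlanarSkeletonFrmQuasi` (p507026): «SkelFrmQuasiBChoiceResidF»

ORIGINAL TITLE: N2 (frames-only node `SamePDropOfSkeletonFrm₁`, OPEN) — (ζ″) ledger: THE (F)-COLUMN RESIDUAL SLOT FUNCTIONS `NegB.gxFc / fxFc / exFc` AND THEIR FLOOR LEMMAS

builds on p205010 (kernel theorem, internal audit signed; external expert review pending) — nothing in this file uses p205010; NOTHING is claimed about any open node
((N3-b), the end state).  Lane `prim-bschramm`, seat `prim-bschramm-p3` (gen 30; design owner; tool = captain gen-1 g4's port_genq.py R-14 --cone + p3-g30 slot-value patch T1).  Helper file (`--supports stmt-CriticalPhenomena-4575 --as helper`).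
PORT RULES (U-wave r1–r4 re-used, GEN-Q hunk classes of p3-g29 #6136): declaration order, names and proof texts are those of «SkelFrmFromBChoiceResidF», byte-identical except
(i) the carrier token `PlanarSkeletonFrmFrom ↦ PlanarSkeletonFrmQuasi` in binders, `namespace`/`end` lines and qualified names (module names `SkelFrmFrom… ↦ SkelFrmQuasi…`
in imports of already-ported rows); (ii) `Φ.step ↦ Φ.qstep` with the called Steps lemma replaced by its `…Q`/`_q` twin and the cost `Φ.M` threaded (none in this file unless
listed below); (iii) `Φ.cyl_connected ↦ Φ.cyl_reach` readers (none unless listed); (iv) graph-ball radii / window floors ×`Φ.M` — IN THIS FILE the (F) excess residual `exFc mk c := max (Φ.M·πBudX …) (Φ.M·πBudY …)` and `exFc_at/exFc_floors` in the ×M shape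
(the quasi face assemblies' `hrX/hrY : Φ.M·πBud· ≤ r`, BVC2-Q design B′); (none other unless listed); (v) L-KitS-1 (design-owner ruling 2026-08-27): the (S0) kit data of «SkelFrmQuasiBChoiceNums» (stmt-g33, G017) are
N-parametrised — IN THIS FILE the readers `KS0.R'0/r₀0/r₀0_ge/base0/reach0 ↦ …N` resp. `KS.RA' ↦ KS.RAN'`, instantiated at `N := KS.NQ Φ = 13·max Φ.M 1`, nothing else.  Carrier-free
residents stay imported/exported from the original «SkelFrmBChoiceResidF» exactly as in the FrmFrom port.  Docstrings and citations are the original's.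

-/

noncomputable section

open scoped Classical

namespace Summit.CriticalPhenomena.PercolationContinuityZ3.Theorems.Transplant

namespace PlanarSkeletonFrmQuasi

namespace NegB

open Literature.Probability.Percolation Literature.Probability.LatticeModels SimpleGraph
open SkelConc (Consts)
open Skelφ.StepI (DataNS OutNS)
open Neg

/-! ## §1 The (F)-column residual slot functions -/

/-- **The (F)-column BOX residual** `gxFc mk c := max {22000·Kq·(R′0+2), 64·S_F c mk}`. [this work] -/
def gxFc (mk c : ℕ) : Neg.FSlot := fun κ _ _ _ _ _ Φ t p D =>
  max (22000 * Neg.Kq κ * (KS0.R'0N κ Φ (KS.NQ Φ) t p D mk + 2)) (64 * KS.SF κ Φ t p D c mk)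

/-- **The (F)-column WIDTH residual** `fxFc mk := 2400·Kq·(R′0+2)`. [this work] -/
def fxFc (mk : ℕ) : Neg.FSlot := fun κ _ _ _ _ _ Φ t p D => 2400 * Neg.Kq κ * (KS0.R'0N κ Φ (KS.NQ Φ) t p D mk + 2)

/-- **The (F)-column EXCESS residual** — GEN-Q hunk (iv), the ×M face reach budgets of record (design owner p3-g30; p5-g28 #6369 / stmt-g33's BVC2-Q design B′:
the quasi face assemblies read `hrX : Φ.M·πBudX ≤ r`, `hrY : Φ.M·πBudY ≤ r`): `exFc mk c := max {Φ.M·πBudX c mk g f, Φ.M·πBudY c mk g f}` (FrmFrom = the case M = 1). [this work] -/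
def exFc (mk c : ℕ) : GSlot := fun κ _ _ _ _ _ Φ t p D g f => max (Φ.M * KS.πBudX κ Φ t p D c mk g f) (Φ.M * KS.πBudY κ Φ t p D c mk g f)

section Floors

variable (κ : Consts) {V : Type} [DecidableEq V] [Countable V] {G : SimpleGraph V} [G.LocallyFinite] (Φ : PlanarSkeletonFrmQuasi G) (t : V) (p : unitInterval)
  (D : DataNS V) (g f mk c : ℕ)

/-- `gxFc` by name. [folklore] -/
theorem gxFc_at (κ : Consts) {V : Type} [DecidableEq V] [Countable V] {G : SimpleGraph V} [G.LocallyFinite] (Φ : PlanarSkeletonFrmQuasi G) (t : V) (p : unitInterval) (D : DataNS V) (mk : ℕ) (c : ℕ) : gxFc mk c κ Φ t p D = max (22000 * Neg.Kq κ * (KS0.R'0N κ Φ (KS.NQ Φ) t p D mk + 2)) (64 * KS.SF κ Φ t p D c mk) := rfl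

/-- `fxFc` by name. [folklore] -/
theorem fxFc_at (κ : Consts) {V : Type} [DecidableEq V] [Countable V] {G : SimpleGraph V} [G.LocallyFinite] (Φ : PlanarSkeletonFrmQuasi G) (t : V) (p : unitInterval) (D : DataNS V) (mk : ℕ) : fxFc mk κ Φ t p D = 2400 * Neg.Kq κ * (KS0.R'0N κ Φ (KS.NQ Φ) t p D mk + 2) := rfl

/-- `exFc` by name. [folklore] -/
theorem exFc_at (κ : Consts) {V : Type} [DecidableEq V] [Countable V] {G : SimpleGraph V} [G.LocallyFinite] (Φ : PlanarSkeletonFrmQuasi G) (t : V) (p : unitInterval) (D : DataNS V) (g : ℕ) (f : ℕ) (mk : ℕ) (c : ℕ) : exFc mk c κ Φ t p D g f = max (Φ.M * KS.πBudX κ Φ t p D c mk g f) (Φ.M * KS.πBudY κ Φ t p D c mk g f) := rfl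

/-- **The two box floors inside `gxFc`.** [folklore] -/
theorem gxFc_floors (κ : Consts) {V : Type} [DecidableEq V] [Countable V] {G : SimpleGraph V} [G.LocallyFinite] (Φ : PlanarSkeletonFrmQuasi G) (t : V) (p : unitInterval) (D : DataNS V) (mk : ℕ) (c : ℕ) : 22000 * Neg.Kq κ * (KS0.R'0N κ Φ (KS.NQ Φ) t p D mk + 2) ≤ gxFc mk c κ Φ t p D ∧ 64 * KS.SF κ Φ t p D c mk ≤ gxFc mk c κ Φ t p D := by
  refine ⟨?_, ?_⟩ <;> rw [gxFc_at] <;> omega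

/-- **The two ×M reach budgets inside `exFc`** (the quasi `hrX/hrY` shapes). [folklore] -/
theorem exFc_floors (κ : Consts) {V : Type} [DecidableEq V] [Countable V] {G : SimpleGraph V} [G.LocallyFinite] (Φ : PlanarSkeletonFrmQuasi G) (t : V) (p : unitInterval) (D : DataNS V) (g : ℕ) (f : ℕ) (mk : ℕ) (c : ℕ) : Φ.M * KS.πBudX κ Φ t p D c mk g f ≤ exFc mk c κ Φ t p D g f ∧ Φ.M * KS.πBudY κ Φ t p D c mk g f ≤ exFc mk c κ Φ t p D g f := by
  refine ⟨?_, ?_⟩ <;> rw [exFc_at] <;> omega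

/-- The width floor inside `fxFc` (equality). [folklore] -/
theorem fxFc_floor (κ : Consts) {V : Type} [DecidableEq V] [Countable V] {G : SimpleGraph V} [G.LocallyFinite] (Φ : PlanarSkeletonFrmQuasi G) (t : V) (p : unitInterval) (D : DataNS V) (mk : ℕ) : 2400 * Neg.Kq κ * (KS0.R'0N κ Φ (KS.NQ Φ) t p D mk + 2) ≤ fxFc mk κ Φ t p D := le_of_eq (fxFc_at κ Φ t p D mk).symm

end Floors

/-! ## §2 Transfer to any dominating slot value (the node file's `gxQ/fxQ/exQ ⊒ gxFc/fxFc/exFc`) -/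

section Transfer

variable {κ : Consts} {V : Type} [DecidableEq V] [Countable V] {G : SimpleGraph V} [G.LocallyFinite] {Φ : PlanarSkeletonFrmQuasi G} {t : V} {p : unitInterval}
  {mk c : ℕ}

/-- **J19 box floors at `g := KS.gT mk gx`** from any box residual dominating `gxFc`: `22000·Kq·(R′0+2) ≤ M_L` and the Kq-free `22000·(R′0+2) ≤ M_L`
(the HA files' `hMR0`/`hR0`). [folklore] -/
theorem hR0F_of_ge {κ : Consts} {V : Type} [DecidableEq V] [Countable V] {G : SimpleGraph V} [G.LocallyFinite] {Φ : PlanarSkeletonFrmQuasi G} {t : V} {p : unitInterval} {mk : ℕ} {c : ℕ} {gx : Neg.FSlot} (h : ∀ D : DataNS V, gxFc mk c κ Φ t p D ≤ gx κ Φ t p D) (D : DataNS V) :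
    22000 * Neg.Kq κ * (KS0.R'0N κ Φ (KS.NQ Φ) t p D mk + 2) ≤ ML κ Φ t p D (KS.gT mk gx κ Φ t p D) ∧
      22000 * (KS0.R'0N κ Φ (KS.NQ Φ) t p D mk + 2) ≤ ML κ Φ t p D (KS.gT mk gx κ Φ t p D) := by
  have h1 := (gxFc_floors κ Φ t p D mk c).1.trans ((h D).trans ((KS.gT_floors κ Φ t p D mk gx).2.2.2.trans (ML_le_ML κ Φ t p D _).2))
  have hKq := Neg.one_le_Kq κ
  refine ⟨h1, le_trans ?_ h1⟩
  calc 22000 * (KS0.R'0N κ Φ (KS.NQ Φ) t p D mk + 2) = 22000 * 1 * (KS0.R'0N κ Φ (KS.NQ Φ) t p D mk + 2) := by ring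
    _ ≤ 22000 * Neg.Kq κ * (KS0.R'0N κ Φ (KS.NQ Φ) t p D mk + 2) := by gcongr

/-- **`hS64 : 64·S_F ≤ M_L (KS.gT mk gx)`** from any box residual dominating `gxFc`. [folklore] -/
theorem hS64_of_ge {κ : Consts} {V : Type} [DecidableEq V] [Countable V] {G : SimpleGraph V} [G.LocallyFinite] {Φ : PlanarSkeletonFrmQuasi G} {t : V} {p : unitInterval} {mk : ℕ} {c : ℕ} {gx : Neg.FSlot} (h : ∀ D : DataNS V, gxFc mk c κ Φ t p D ≤ gx κ Φ t p D) (D : DataNS V) :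
    64 * KS.SF κ Φ t p D c mk ≤ ML κ Φ t p D (KS.gT mk gx κ Φ t p D) :=
  (gxFc_floors κ Φ t p D mk c).2.trans ((h D).trans ((KS.gT_floors κ Φ t p D mk gx).2.2.2.trans (ML_le_ML κ Φ t p D _).2))

/-- **`hS : 16·S_F ≤ M_L (KS.gT mk gx)`** (from `hS64`). [folklore] -/
theorem hS_of_ge {κ : Consts} {V : Type} [DecidableEq V] [Countable V] {G : SimpleGraph V} [G.LocallyFinite] {Φ : PlanarSkeletonFrmQuasi G} {t : V} {p : unitInterval} {mk : ℕ} {c : ℕ} {gx : Neg.FSlot} (h : ∀ D : DataNS V, gxFc mk c κ Φ t p D ≤ gx κ Φ t p D) (D : DataNS V) :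
    16 * KS.SF κ Φ t p D c mk ≤ ML κ Φ t p D (KS.gT mk gx κ Φ t p D) :=
  le_trans (by omega) (hS64_of_ge h D)

/-- **J19 `hℓA`**: `22000·Kq·(R′0+2) ≤ ℓ_L` at `KS.gT mk gx`, under the numeric long clause (`M_L + 1 ≤ ℓ_L`). [folklore] -/
theorem hℓAF_of_ge {κ : Consts} {V : Type} [DecidableEq V] [Countable V] {G : SimpleGraph V} [G.LocallyFinite] {Φ : PlanarSkeletonFrmQuasi G} {t : V} {p : unitInterval} {mk : ℕ} {c : ℕ} {gx : Neg.FSlot} (h : ∀ D : DataNS V, gxFc mk c κ Φ t p D ≤ gx κ Φ t p D) (D : DataNS V) {f : ℕ}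
    (hN : EqNumL κ Φ t p D (KS.gT mk gx κ Φ t p D) f) : 22000 * Neg.Kq κ * (KS0.R'0N κ Φ (KS.NQ Φ) t p D mk + 2) ≤ ℓL κ Φ t p D (KS.gT mk gx κ Φ t p D) f := by
  have h1 := (hR0F_of_ge h D).1
  have h2 := hN.ℓ_le
  have h1' : ((22000 * Neg.Kq κ * (KS0.R'0N κ Φ (KS.NQ Φ) t p D mk + 2) : ℕ) : ℤ) ≤ (ML κ Φ t p D (KS.gT mk gx κ Φ t p D) : ℤ) := by exact_mod_cast h1
  have : ((22000 * Neg.Kq κ * (KS0.R'0N κ Φ (KS.NQ Φ) t p D mk + 2) : ℕ) : ℤ) ≤ (ℓL κ Φ t p D (KS.gT mk gx κ Φ t p D) f : ℕ) := by linarith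
  exact_mod_cast this

/-- **`hnA24`**: `2400·Kq·(R′0+2) ≤ n_L g (KS.fT mk fx)` from any width residual dominating `fxFc` (EqNumL-free, any box value `g`). [folklore] -/
theorem hnA24_of_ge {κ : Consts} {V : Type} [DecidableEq V] [Countable V] {G : SimpleGraph V} [G.LocallyFinite] {Φ : PlanarSkeletonFrmQuasi G} {t : V} {p : unitInterval} {mk : ℕ} {fx : Neg.FSlot} (h : ∀ D : DataNS V, fxFc mk κ Φ t p D ≤ fx κ Φ t p D) (D : DataNS V) (g : ℕ) :
    2400 * Neg.Kq κ * (KS0.R'0N κ Φ (KS.NQ Φ) t p D mk + 2) ≤ nL κ Φ t p D g (KS.fT mk fx κ Φ t p D) :=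
  (fxFc_floor κ Φ t p D mk).trans ((h D).trans (((KS.fT_floors κ Φ t p D mk fx).2.2.2).trans (n₁L_le_nL κ Φ t p D g _).2))

/-- **`hnA`**: `2000·Kq·(R′0+2) ≤ n_L g (KS.fT mk fx)` (from `hnA24`). [folklore] -/
theorem hnAF_of_ge {κ : Consts} {V : Type} [DecidableEq V] [Countable V] {G : SimpleGraph V} [G.LocallyFinite] {Φ : PlanarSkeletonFrmQuasi G} {t : V} {p : unitInterval} {mk : ℕ} {fx : Neg.FSlot} (h : ∀ D : DataNS V, fxFc mk κ Φ t p D ≤ fx κ Φ t p D) (D : DataNS V) (g : ℕ) :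
    2000 * Neg.Kq κ * (KS0.R'0N κ Φ (KS.NQ Φ) t p D mk + 2) ≤ nL κ Φ t p D g (KS.fT mk fx κ Φ t p D) :=
  le_trans (Nat.mul_le_mul_right _ (Nat.mul_le_mul_right _ (by norm_num))) (hnA24_of_ge h D g)

/-- **`hRn0`**: `R′0 ≤ n_L g (KS.fT mk fx)` (from `hnA`). [folklore] -/
theorem hRn0F_of_ge {κ : Consts} {V : Type} [DecidableEq V] [Countable V] {G : SimpleGraph V} [G.LocallyFinite] {Φ : PlanarSkeletonFrmQuasi G} {t : V} {p : unitInterval} {mk : ℕ} {fx : Neg.FSlot} (h : ∀ D : DataNS V, fxFc mk κ Φ t p D ≤ fx κ Φ t p D) (D : DataNS V) (g : ℕ) :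
    KS0.R'0N κ Φ (KS.NQ Φ) t p D mk ≤ nL κ Φ t p D g (KS.fT mk fx κ Φ t p D) := by
  have h1 := hnAF_of_ge h D g
  have hKq := Neg.one_le_Kq κ
  have : KS0.R'0N κ Φ (KS.NQ Φ) t p D mk ≤ 2000 * Neg.Kq κ * (KS0.R'0N κ Φ (KS.NQ Φ) t p D mk + 2) := by nlinarith
  exact this.trans h1

-- GEN-Q (R-2, captain 2026-08-27): `PlanarSkeletonFrmFrom.NegB.hπX_of_ge` is not in the used cone of the node top — not ported.

-- GEN-Q (R-2, captain 2026-08-27): `PlanarSkeletonFrmFrom.NegB.hπY_of_ge` is not in the used cone of the node top — not ported.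

end Transfer

end NegB

end PlanarSkeletonFrmQuasi

end Summit.CriticalPhenomena.PercolationContinuityZ3.Theorems.Transplant

end
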